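import Summits.CriticalPhenomena.SAWScalingLimit.Theorems.ConfinementPositivity.Negative.Cusp4Detours
import Literature.Probability.RandomPlanarGeometry.SAWRestrictionCovariance
import Literature.Probability.RandomPlanarGeometry.SAWBridgeRadius

/-!
# `ConfinementPositivity` (stmt-CriticalPhenomena-17587) — negative knowledge, cusp series part 5: replacing the bare run by a detour

Refuter crux-attack support file (cdisprove).  At `δ = 1/k²` (`k ≥ 5`), for walks from
`a_δ = (1,0)` to an axis site `(B, 0)` beyond the corridor (`B ≥ 4k + 1`):

* `exists_detour_injection` — replacing the forced bare run of a self-avoiding walk of the cusp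
  `Ω'_δ` by any of the `4k - 1` detours (inside `Ω_δ ∖ Ω'_δ`) yields a self-avoiding walk of the
  fat domain `Ω_δ` with exactly `4` more steps; the pair (detour, walk) is recovered from the
  result (injectivity: the detour index is read at position `j + 1`, the walk from its first `4k`
  vertices — the forced run — and the common remainder);
* `fat_weight_ge` — hence `(4k - 1) · x_c⁴ · Z_{Ω'_δ}(a_δ, b) ≤ Z_{Ω_δ}(a_δ, b)`
  (`ENNReal.tsum_comp_le_tsum_of_injective` on `SAW.weight_apply_eq_tsum_indicator`).

Def-free helper; everything proved, standard axioms. [folklore]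
-/

noncomputable section

namespace Summit.CriticalPhenomena.SAWScalingLimit.Theorems.ConfinementPositivity.Negative

open Set Metric Filter Topology Complex MeasureTheory
open scoped ENNReal
open Literature.Probability.RandomPlanarGeometry Literature.Probability.LatticeModels
open Summit.CriticalPhenomena.SAWScalingLimit.Theorems.ShellCrossingBound.Negative.Forcing
  (meshPoint_vec vec_add_single_zero vec_add_single_one eq_vec)

/-! ### Replacing the bare run by a detour -/

/-- **Detour injection.** At `δ = 1/k²` (`k ≥ 5`), for walks from `a_δ = (1,0)` to an axis site
`(B, 0)` beyond the corridor: replacing the forced bare run `(1,0) … (4k,0)` of a self-avoiding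
walk of the cusp `Ω'_δ` by any of the `4k - 1` detours through the rows `-1, -2` of `Ω_δ ∖ Ω'_δ`
yields a self-avoiding walk of the fat domain `Ω_δ` with exactly `4` more steps, and the pair
(detour, walk) can be read off the result. [folklore] -/
theorem exists_detour_injection {Ωc Ωf : Set ℂ}
    (hC : ∀ z : ℂ, z ∈ Ωc ↔ 0 < z.re ∧ z.re < 1 ∧ -(z.re ^ 2 / 16) < z.im ∧ z.im < z.re ^ 2 / 16)
    (hF : ∀ z : ℂ, z ∈ Ωf ↔ 0 < z.re ∧ z.re < 1 ∧ -1 < z.im ∧ z.im < z.re ^ 2 / 16)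
    {k : ℕ} (hk : 5 ≤ k) {B : ℤ} (hB : 4 * (k : ℤ) + 1 ≤ B) :
    ∃ Φ : Fin (4 * k - 1) × SAW.DomainSAW Ωc (((k : ℝ) ^ 2)⁻¹) ![1, 0] ![B, 0] →
        SAW.DomainSAW Ωf (((k : ℝ) ^ 2)⁻¹) ![1, 0] ![B, 0],
      Function.Injective Φ ∧ ∀ p, (Φ p).length = p.2.length + 4 := by
  -- scales
  set δ : ℝ := ((k : ℝ) ^ 2)⁻¹ with hδdef
  have hk1 : 1 ≤ k := by omega
  have hkR : (5 : ℝ) ≤ k := by exact_mod_cast hk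
  have hδpos : 0 < δ := by positivity
  have hδ1 : δ < 1 := by
    rw [hδdef]
    apply inv_lt_one_of_one_lt₀
    nlinarith
  have hk' : (5 : ℤ) ≤ k := by exact_mod_cast hk
  set K : ℕ := 4 * k with hKdef
  have hKk : (K : ℤ) < (k : ℤ) ^ 2 := by rw [hKdef]; push_cast; nlinarith
  -- the two discrete domains, nested
  set G' := discreteDomainGraph Ωc δ with hG'def
  set G := discreteDomainGraph Ωf δ with hGdef
  have hadjF : ∀ {x y : Site 2}, G.Adj x y ↔
      (zdGraph 2).Adj x y ∧ x ∈ meshVertices Ωf δ ∧ y ∈ meshVertices Ωf δ := fun {x y} =>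
    strip_dd_adj_iff (lo := fun _ : ℝ => (-1 : ℝ)) (hi := fun x : ℝ => x ^ 2 / 16) hF fat_sign
      monotoneOn_sq_div antitoneOn_const_neg_one hδpos hδ1
  have hadjC : ∀ {x y : Site 2}, G'.Adj x y ↔
      (zdGraph 2).Adj x y ∧ x ∈ meshVertices Ωc δ ∧ y ∈ meshVertices Ωc δ := fun {x y} =>
    strip_dd_adj_iff (lo := fun x : ℝ => -(x ^ 2 / 16)) (hi := fun x : ℝ => x ^ 2 / 16) hC
      cusp_sign monotoneOn_sq_div antitoneOn_neg_sq_div hδpos hδ1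
  have hle : G' ≤ G := by
    intro x y h
    rw [hadjC] at h
    rw [hadjF]
    exact ⟨h.1, cusp_mesh_subset_fat hC hF δ h.2.1, cusp_mesh_subset_fat hC hF δ h.2.2⟩
  -- the detour vertex function
  set f : ℕ → ℕ → Site 2 := fun j i => if i = 0 then ![1, 0] else if i ≤ j then ![(i : ℤ), -1]
    else if i ≤ K + 1 then ![(i : ℤ) - 1, -2] else if i = K + 2 then ![(K : ℤ), -1]
    else ![(K : ℤ), 0] with hfdef
  have hf : ∀ j i : ℕ, f j i = if i = 0 then ![1, 0] else if i ≤ j then ![(i : ℤ), -1]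
      else if i ≤ K + 1 then ![(i : ℤ) - 1, -2] else if i = K + 2 then ![(K : ℤ), -1]
      else ![(K : ℤ), 0] := fun j i => rfl
  -- detour vertices: in `Ω_δ`; the interior ones are not in `Ω'_δ`
  have hmemF : ∀ j, 1 ≤ j → j + 1 ≤ K → ∀ i ≤ K + 3, f j i ∈ meshVertices Ωf δ := by
    intro j hj1 hj i hi
    rcases Nat.eq_zero_or_pos i with rfl | hi1
    · rw [detour_val_zero hf]
      exact fat_axis_mem hF hk1 le_rfl (by nlinarith)
    rcases Nat.lt_or_ge (K + 2) i with hlast | hiK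
    · obtain rfl : i = K + 3 := by omega
      rw [detour_val_D hf hj]
      exact fat_axis_mem hF hk1 (by omega) hKk
    · obtain ⟨m, n, hmn, hm1, hmK, hn⟩ := detour_interior hf hj1 hj hi1 hiK
      rw [hmn]
      exact fat_low_mem hF hk hm1 (by omega) hn
  have hnotC : ∀ j, 1 ≤ j → j + 1 ≤ K → ∀ i, 1 ≤ i → i ≤ K + 2 → f j i ∉ meshVertices Ωc δ := by
    intro j hj1 hj i hi1 hi
    obtain ⟨m, n, hmn, hm1, hmK, hn⟩ := detour_interior hf hj1 hj hi1 hi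
    rw [hmn]
    exact cusp_offaxis_not_mem hC hk1 hm1 (by omega) (by rcases hn with rfl | rfl <;> norm_num)
  -- the detour lists
  have hchain : ∀ j, 1 ≤ j → j + 1 ≤ K →
      (List.ofFn (fun i : Fin (K + 4) => f j i)).IsChain G.Adj := by
    intro j hj1 hj
    rw [List.isChain_iff_getElem]
    intro i hi
    simp only [List.length_ofFn] at hi
    simp only [List.getElem_ofFn]
    rw [hadjF]
    exact ⟨detour_zd_adj hf hj1 hj (by omega), hmemF j hj1 hj i (by omega),
      hmemF j hj1 hj (i + 1) (by omega)⟩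
  have hne : ∀ j, List.ofFn (fun i : Fin (K + 4) => f j i) ≠ [] := fun j h => by
    simpa using congrArg List.length h
  have hhead : ∀ j, (List.ofFn (fun i : Fin (K + 4) => f j i)).head (hne j) = ![1, 0] := by
    intro j
    rw [List.head_ofFn]
    exact detour_val_zero hf j
  have hlast : ∀ j, j + 1 ≤ K →
      (List.ofFn (fun i : Fin (K + 4) => f j i)).getLast (hne j) = ![(K : ℤ), 0] := by
    intro j hj
    rw [List.getLast_ofFn]
    exact detour_val_D hf hj
  have hnodup : ∀ j, 1 ≤ j → j + 1 ≤ K → (List.ofFn (fun i : Fin (K + 4) => f j i)).Nodup := by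
    intro j hj1 hj
    rw [List.nodup_ofFn]
    intro i₁ i₂ h
    exact Fin.ext (detour_injOn hf hj1 hj (by omega) (by omega) h)
  -- the cusp walks: forced run, length, vertices
  have hrun : ∀ (γ : SAW.DomainSAW Ωc δ ![1, 0] ![B, 0]) (i : ℕ), i + 1 ≤ K →
      γ.walk.getVert i = ![(i : ℤ) + 1, 0] := fun γ i hi =>
    cusp_forced_run hC hk1 hB γ.walk γ.isPath i hi
  have hT : ∀ γ : SAW.DomainSAW Ωc δ ![1, 0] ![B, 0], γ.walk.getVert (K - 1) = ![(K : ℤ), 0] := by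
    intro γ
    rw [hrun γ (K - 1) (by omega)]
    have e : ((K - 1 : ℕ) : ℤ) + 1 = K := by omega
    rw [e]
  have hKlen : ∀ γ : SAW.DomainSAW Ωc δ ![1, 0] ![B, 0], K ≤ γ.walk.length := by
    intro γ
    by_contra hlt
    push Not at hlt
    have h1 := γ.walk.getVert_of_length_le (Nat.le_sub_one_of_lt hlt)
    rw [hT γ] at h1
    have h2 := congrFun h1 0
    simp only [Matrix.cons_val_zero] at h2
    omega
  have hsuppC : ∀ (γ : SAW.DomainSAW Ωc δ ![1, 0] ![B, 0]), ∀ w ∈ γ.walk.support,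
      w ∈ meshVertices Ωc δ := fun γ w hw =>
    meshDomain_subset_meshVertices _ _ (support_subset_meshDomain γ.walk (by have := hKlen γ; omega) w hw)
  have htake : ∀ γ : SAW.DomainSAW Ωc δ ![1, 0] ![B, 0],
      γ.walk.support.take K = List.ofFn (fun i : Fin K => (![(i : ℤ) + 1, 0] : Site 2)) := by
    intro γ
    apply List.ext_getElem
    · simp only [List.length_take, SimpleGraph.Walk.length_support, List.length_ofFn]
      have := hKlen γ
      omega
    · intro i h₁ h₂
      simp only [List.length_ofFn] at h₂
      rw [List.getElem_take, List.getElem_ofFn, SimpleGraph.Walk.support_getElem_eq_getVert]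
      exact hrun γ i (by omega)
  -- the tails (transferred to `Ω_δ`) and the detour walks
  let T : SAW.DomainSAW Ωc δ ![1, 0] ![B, 0] → G.Walk ![(K : ℤ), 0] ![B, 0] := fun γ =>
    ((γ.walk.drop (K - 1)).copy (hT γ) rfl).mapLe hle
  have hTsupp : ∀ γ, (T γ).support = γ.walk.support.drop (K - 1) := by
    intro γ
    simp only [T, SimpleGraph.Walk.support_mapLe_eq_support, SimpleGraph.Walk.support_copy]
    rw [SimpleGraph.Walk.drop_support_eq_support_drop_min, min_eq_left (by have := hKlen γ; omega)]
  have hTlen : ∀ γ, (T γ).length = γ.walk.length - (K - 1) := by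
    intro γ
    have h1 := (T γ).length_support
    rw [hTsupp, List.length_drop, SimpleGraph.Walk.length_support] at h1
    have := hKlen γ
    omega
  let Dw : Fin (K - 1) → G.Walk ![1, 0] ![(K : ℤ), 0] := fun jj =>
    (SimpleGraph.Walk.ofSupport _ (hne (jj.1 + 1))
      (hchain (jj.1 + 1) (by omega) (by omega))).copy (hhead _) (hlast _ (by omega))
  have hDsupp : ∀ jj, (Dw jj).support = List.ofFn (fun i : Fin (K + 4) => f (jj.1 + 1) i) := by
    intro jj
    simp only [Dw, SimpleGraph.Walk.support_copy, SimpleGraph.Walk.support_ofSupport]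
  have hDlen : ∀ jj, (Dw jj).length = K + 3 := by
    intro jj
    simp only [Dw, SimpleGraph.Walk.length_copy, SimpleGraph.Walk.length_ofSupport,
      List.length_ofFn]
    omega
  -- the glued walks are self-avoiding
  have hpath : ∀ jj γ, ((Dw jj).append (T γ)).IsPath := by
    intro jj γ
    have hj1 : 1 ≤ jj.1 + 1 := by omega
    have hj : jj.1 + 1 + 1 ≤ K := by omega
    rw [SimpleGraph.Walk.isPath_def, SimpleGraph.Walk.support_append, hDsupp, hTsupp,
      List.tail_drop, List.nodup_append]
    have hKK : K - 1 + 1 = K := by omega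
    rw [hKK]
    have hγnd : γ.walk.support.Nodup := γ.isPath.support_nodup
    refine ⟨hnodup _ hj1 hj, hγnd.sublist (List.drop_sublist _ _), ?_⟩
    intro a ha b hb hab
    subst hab
    rw [List.mem_ofFn] at ha
    obtain ⟨i, rfl⟩ := ha
    obtain ⟨t, ht, hbt⟩ := List.mem_iff_getElem.1 hb
    rw [List.getElem_drop] at hbt
    simp only [List.length_drop, SimpleGraph.Walk.length_support] at ht
    rcases Nat.eq_zero_or_pos i.1 with hi0 | hi1
    · -- `a = (1,0) = γ₀`
      have ha0 : f (jj.1 + 1) i = γ.walk.support[0]'(by simp) := by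
        rw [hi0, detour_val_zero hf, SimpleGraph.Walk.support_getElem_eq_getVert,
          SimpleGraph.Walk.getVert_zero]
      rw [ha0] at hbt
      have := (hγnd.getElem_inj_iff).1 hbt
      omega
    rcases Nat.lt_or_ge (K + 2) i.1 with hlast' | hiK
    · -- `a = (K,0) = γ_{K-1}`
      have hiv : (i : ℕ) = K + 3 := by omega
      have ha0 : f (jj.1 + 1) i = γ.walk.support[K - 1]'(by
          rw [SimpleGraph.Walk.length_support]; have := hKlen γ; omega) := by
        rw [hiv, detour_val_D hf hj, SimpleGraph.Walk.support_getElem_eq_getVert, hT γ]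
      rw [ha0] at hbt
      have := (hγnd.getElem_inj_iff).1 hbt
      omega
    · -- interior detour vertex: not a cusp vertex, unlike `b`
      have hbC : γ.walk.support[K + t]'(by rw [SimpleGraph.Walk.length_support]; omega) ∈
          meshVertices Ωc δ := hsuppC γ _ (List.getElem_mem _)
      rw [hbt] at hbC
      exact hnotC _ hj1 hj i hi1 hiK hbC
  -- the map
  refine ⟨fun p => ⟨(Dw p.1).append (T p.2), hpath p.1 p.2⟩, ?_, ?_⟩
  · -- injectivity
    rintro ⟨jj, γ⟩ ⟨jj', γ'⟩ h
    have hs := congrArg (fun ω : SAW.DomainSAW Ωf δ ![1, 0] ![B, 0] => ω.walk.support) h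
    simp only [SimpleGraph.Walk.support_append, hDsupp, hTsupp] at hs
    obtain ⟨hl, hr⟩ := List.append_inj hs (by simp)
    -- the detour index
    have hjj : jj = jj' := by
      rcases lt_trichotomy jj.1 jj'.1 with hlt | heq | hgt
      · exfalso
        have e := List.getElem_of_eq hl (i := jj.1 + 2) (by simp; omega)
        simp only [List.getElem_ofFn] at e
        exact detour_ne hf (j := jj.1 + 1) (j' := jj'.1 + 1) (by omega) (by omega) e
      · exact Fin.ext heq
      · exfalso
        have e := List.getElem_of_eq hl (i := jj'.1 + 2) (by simp; omega)
        simp only [List.getElem_ofFn] at e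
        exact detour_ne hf (j := jj'.1 + 1) (j' := jj.1 + 1) (by omega) (by omega) e.symm
    subst hjj
    -- the walk: same first `K` vertices (forced run), same rest
    have hKK : K - 1 + 1 = K := by omega
    rw [List.tail_drop, List.tail_drop, hKK] at hr
    have hsupp : γ.walk.support = γ'.walk.support := by
      rw [← List.take_append_drop K γ.walk.support, ← List.take_append_drop K γ'.walk.support,
        htake γ, htake γ', hr]
    have hγ : γ = γ' := SAW.DomainSAW.ext_support hsupp
    subst hγ
    rfl
  · -- lengths
    rintro ⟨jj, γ⟩
    show ((Dw jj).append (T γ)).length = γ.walk.length + 4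
    rw [SimpleGraph.Walk.length_append, hDlen, hTlen]
    have := hKlen γ
    omega

/-- **The entropy of the detours**: at `δ = 1/k²` (`k ≥ 5`), for walks from `a_δ = (1, 0)` to an
axis site `(B, 0)` beyond the corridor,
`(4k - 1) · x_c⁴ · Z_{Ω'_δ}(a_δ, b) ≤ Z_{Ω_δ}(a_δ, b)`: the fat domain's critical partition
function beats the cusp's by the number of detours, up to the fixed factor `x_c⁴`. [folklore] -/
theorem fat_weight_ge {Ωc Ωf : Set ℂ}
    (hC : ∀ z : ℂ, z ∈ Ωc ↔ 0 < z.re ∧ z.re < 1 ∧ -(z.re ^ 2 / 16) < z.im ∧ z.im < z.re ^ 2 / 16)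
    (hF : ∀ z : ℂ, z ∈ Ωf ↔ 0 < z.re ∧ z.re < 1 ∧ -1 < z.im ∧ z.im < z.re ^ 2 / 16)
    {k : ℕ} (hk : 5 ≤ k) {B : ℤ} (hB : 4 * (k : ℤ) + 1 ≤ B) :
    ((4 * k - 1 : ℕ) : ℝ≥0∞) * ENNReal.ofReal (SAW.criticalFugacity ^ 4) *
        SAW.weight Ωc (((k : ℝ) ^ 2)⁻¹) ![1, 0] ![B, 0] Set.univ ≤
      SAW.weight Ωf (((k : ℝ) ^ 2)⁻¹) ![1, 0] ![B, 0] Set.univ := by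
  obtain ⟨Φ, hinj, hlen⟩ := exists_detour_injection hC hF hk hB
  have hxc : 0 ≤ SAW.criticalFugacity := SAW.criticalFugacity_pos.le
  rw [SAW.weight_apply_eq_tsum_indicator, SAW.weight_apply_eq_tsum_indicator]
  simp only [Set.indicator_univ]
  have key : ∑' p : Fin (4 * k - 1) × SAW.DomainSAW Ωc (((k : ℝ) ^ 2)⁻¹) ![1, 0] ![B, 0],
      ENNReal.ofReal (SAW.criticalFugacity ^ (Φ p).length) ≤
      ∑' ω : SAW.DomainSAW Ωf (((k : ℝ) ^ 2)⁻¹) ![1, 0] ![B, 0],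
        ENNReal.ofReal (SAW.criticalFugacity ^ ω.length) :=
    ENNReal.tsum_comp_le_tsum_of_injective hinj
      (fun ω => ENNReal.ofReal (SAW.criticalFugacity ^ ω.length))
  refine le_trans (le_of_eq ?_) key
  have hconst : ∀ C : ℝ≥0∞, ∑' _a : Fin (4 * k - 1), C = ((4 * k - 1 : ℕ) : ℝ≥0∞) * C :=
    fun C => by
      rw [tsum_fintype, Finset.sum_const, Finset.card_univ, Fintype.card_fin, nsmul_eq_mul]
  calc ((4 * k - 1 : ℕ) : ℝ≥0∞) * ENNReal.ofReal (SAW.criticalFugacity ^ 4) *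
        ∑' γ : SAW.DomainSAW Ωc (((k : ℝ) ^ 2)⁻¹) ![1, 0] ![B, 0],
          ENNReal.ofReal (SAW.criticalFugacity ^ γ.length)
      = ∑' _a : Fin (4 * k - 1), ENNReal.ofReal (SAW.criticalFugacity ^ 4) *
          ∑' γ : SAW.DomainSAW Ωc (((k : ℝ) ^ 2)⁻¹) ![1, 0] ![B, 0],
            ENNReal.ofReal (SAW.criticalFugacity ^ γ.length) := by
        rw [hconst, mul_assoc]
    _ = ∑' (a : Fin (4 * k - 1)), ∑' (γ : SAW.DomainSAW Ωc (((k : ℝ) ^ 2)⁻¹) ![1, 0] ![B, 0]),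
          ENNReal.ofReal (SAW.criticalFugacity ^ 4) *
            ENNReal.ofReal (SAW.criticalFugacity ^ γ.length) := by
        simp_rw [ENNReal.tsum_mul_left]
    _ = ∑' p : Fin (4 * k - 1) × SAW.DomainSAW Ωc (((k : ℝ) ^ 2)⁻¹) ![1, 0] ![B, 0],
          ENNReal.ofReal (SAW.criticalFugacity ^ 4) *
            ENNReal.ofReal (SAW.criticalFugacity ^ p.2.length) :=
        (ENNReal.tsum_prod (f := fun (_ : Fin (4 * k - 1))
          (γ : SAW.DomainSAW Ωc (((k : ℝ) ^ 2)⁻¹) ![1, 0] ![B, 0]) =>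
            ENNReal.ofReal (SAW.criticalFugacity ^ 4) *
              ENNReal.ofReal (SAW.criticalFugacity ^ γ.length))).symm
    _ = _ := tsum_congr fun p => by
        rw [hlen p, pow_add, ENNReal.ofReal_mul (pow_nonneg hxc _), mul_comm]

end Summit.CriticalPhenomena.SAWScalingLimit.Theorems.ConfinementPositivity.Negative

end
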